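import Summits.ResolutionOfSingularities.ResolutionOfSingularities.Theorems.PurelyInseparableDim4AtlasMemberForestStep
import HarnessLib

/-!
# Purely inseparable four-folds: the NODE THEOREM for an ABSTRACT MEMBER SYSTEM — survival + host step + a well-founded measure on
# reading sets give a marked resolution (brick S3 (c) v4, tranche-independent form of A4/A5; cell `res-dim4-pi`)

[OURS · counted 0] (D-0157 DOOR 2; host item stmt-ResolutionOfSingularities-16155, helper). Nothing here proves resolution of
singularities in dimension ≥ 4 / characteristic `p`. (`res-dim4-typ-3/S3c-V4-ATLAS-MEMBERS-DESIGN.md` §2 A4/A5, made generic so that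
every later tranche of the member format — tranche 1 `MemberDataAT`, tranche 2 `MemberDataAD`, … — re-uses ONE node induction.)

A MEMBER SYSTEM is an abstract member datum `MD M′ c R` (a marked ideal `M′` on a stage `X′`, a closed member `c ⊆ X′`, a finite
«reading set» `R : Finset ρ`) together with a relation `lt` on reading sets, subject to four hypotheses, all of which tranche 1 proved
for `MemberDataAT` (A2 `memberDataAT_survival`, A3 `memberDataAT_host_step`, `coe_member_subset_support_of_atlasZF`,
`acc_readingSet_of_forall_acc`):
* (ADM) a member is an admissible centre: `𝓘(c)` regular, snc with the boundary, `c ⊆ supp M′`;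
* (WF) the reading set of a member is `lt`-accessible, `lt` irreflexive;
* (SURV) a member survives the blow-up of a disjoint centre having snc with the boundary (readings unchanged);
* (HOST) blowing up a member `c` produces finitely many pairwise disjoint CHILDREN over `c`, each a member of the new stage with an
  `lt`-smaller reading set, covering the closed order-`p` points over `c` except finitely many, each of which carries `PointData`.
NODE THEOREM: a node with point members (`PointData`) and pairwise disjoint members of the system covering all closed order-`p` points
has a marked resolution — blow up any member, recurse on `Relation.CutExpand lt` of the multiset of reading sets; with no member left the
point forest (`exists_isMarkedResolution_of_config_local`) finishes.

THIS FILE: **`exists_isMarkedResolution_of_member_forest`** (generic A5, induction on `Relation.CutExpand lt` of the multiset of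
reading sets), **`exists_isMarkedResolution_of_member_node`** (σ = 𝟙). The step (generic A4 `member_node_step`) is `…AtlasMemberForestStep`.

AI-produced formalisation, weaker than expert review. bears_on: LADDER-RESOLUTION:D157-DOOR2 (res-dim4-pi · S3 (c) v4 generic A5).
-/

set_option linter.dupNamespace false -- D-0017: single-problem summit path `Summit.<S>.<S>.…` by design

noncomputable section

open MvPolynomial Finset CategoryTheory AlgebraicGeometry Opposite TopologicalSpace
open AlgebraicGeometry.Scheme.IdealSheafData (ofIdealTop vanishingIdeal)

namespace Summit.ResolutionOfSingularities.ResolutionOfSingularities.Theorems.PIDim4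

open Literature.AlgebraicGeometry.Resolution
open Literature.AlgebraicGeometry.Resolution.Hauser2010
open Literature.AlgebraicGeometry.Resolution.AffinePointBlowup (P A γ coord Wtop ξ)

namespace Equimultiple

section MemberForest

variable {K : Type} [Field K] {p : ℕ} [hp : Fact p.Prime] [CharP K p] [DecidableEq K] [IsAlgClosed K] {ρ : Type}

/-- **THE NODE THEOREM FOR A MEMBER SYSTEM, forest form (generic A5).** Under (ADM), (SURV), (HOST) for `MD`/`lt` (`lt` irreflexive):
for every multiset `T` of reading sets accessible for `Relation.CutExpand lt`, every node over `(X₀, M₀)` whose members' reading sets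
form `T` — point members with `PointData`, pairwise disjoint members with `MD`, points off members, all closed order-`p` points covered —
has a marked resolution of `M₀`. [cite: BierstoneGrigorievMilmanWlodarczyk2011, Def. 3.1.3; §4 Step 2b] [cite: Hauser2010, §§F–G] -/
theorem exists_isMarkedResolution_of_member_forest {X₀ : Scheme.{0}} [IsLocallyNoetherian X₀] [JacobsonSpace X₀]
    (MD : ∀ ⦃X' : Scheme.{0}⦄, MarkedIdeal X' → Closeds X' → Finset ρ → Prop) (lt : Finset ρ → Finset ρ → Prop)
    (hadm : ∀ ⦃X' : Scheme.{0}⦄ [IsLocallyNoetherian X'] (M' : MarkedIdeal X') (c : Closeds X') (R : Finset ρ),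
      M'.mult = p → MD M' c R →
      Scheme.IsRegular (vanishingIdeal c).subscheme ∧ HasSNCWith M'.boundary (vanishingIdeal c) ∧ (c : Set X') ⊆ M'.support)
    (hsurv : ∀ ⦃X' W : Scheme.{0}⦄ [IsLocallyNoetherian X'] [IsLocallyNoetherian W] {π : W ⟶ X'} {Ce : X'.IdealSheafData},
      IsBlowup π Ce → ∀ M' : MarkedIdeal X', M'.mult = p → HasSNCWith M'.boundary Ce →
      ∀ (c : Closeds X') (R : Finset ρ), Disjoint (c : Set X') (Ce.support : Set X') → MD M' c R →
      MD (M'.transform π Ce) (c.preimage π.continuous) R)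
    (hhost : ∀ ⦃X' : Scheme.{0}⦄ [IsLocallyNoetherian X'] (M' : MarkedIdeal X'), M'.mult = p →
      ∀ (c : Closeds X') (R : Finset ρ), MD M' c R →
      ∃ (ι : Type) (I : Finset ι) (kid : ι → Closeds (blowup (vanishingIdeal c))) (Rk : ι → Finset ρ),
        (∀ i ∈ I, MD ((M'.transform (blowup.π (vanishingIdeal c)) (vanishingIdeal c))) (kid i) (Rk i) ∧
          (kid i : Set (blowup (vanishingIdeal c))) ⊆ blowup.π (vanishingIdeal c) ⁻¹' (c : Set X') ∧
          (kid i : Set (blowup (vanishingIdeal c))).Nonempty) ∧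
        (∀ i ∈ I, ∀ i' ∈ I, i ≠ i' →
          Disjoint (kid i : Set (blowup (vanishingIdeal c))) (kid i' : Set (blowup (vanishingIdeal c)))) ∧
        (∀ i ∈ I, lt (Rk i) R) ∧
        (∀ w : blowup (vanishingIdeal c), IsClosed ({w} : Set (blowup (vanishingIdeal c))) →
          blowup.π (vanishingIdeal c) w ∈ (c : Set X') →
          (p : ℕ∞) ≤ idealOrder (M'.transform (blowup.π (vanishingIdeal c)) (vanishingIdeal c)).ideal w →
          (∃ i ∈ I, w ∈ (kid i : Set (blowup (vanishingIdeal c)))) ∨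
          ∃ s : State K, PointData p (M'.transform (blowup.π (vanishingIdeal c)) (vanishingIdeal c)) w s) ∧
        {w : blowup (vanishingIdeal c) | IsClosed ({w} : Set (blowup (vanishingIdeal c))) ∧
          blowup.π (vanishingIdeal c) w ∈ (c : Set X') ∧
          (p : ℕ∞) ≤ idealOrder (M'.transform (blowup.π (vanishingIdeal c)) (vanishingIdeal c)).ideal w ∧
          ∀ i ∈ I, w ∉ (kid i : Set (blowup (vanishingIdeal c)))}.Finite)
    (M₀ : MarkedIdeal X₀) (hE : HasSNC M₀.boundary) (hmult : M₀.mult = p)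
    (T : Multiset (Finset ρ)) (hT : Acc (Relation.CutExpand lt) T) :
    ∀ (X' : Scheme.{0}) (σ : X' ⟶ X₀) (M' : MarkedIdeal X') (_ : IsMultipleBlowup M₀ σ M')
      (pts : Finset X') (st : X' → State K) (_ : ∀ x ∈ pts, IsClosed ({x} : Set X'))
      (_ : ∀ x ∈ pts, PointData p M' x (st x))
      (cms : Finset (Closeds X')) (Rd : Closeds X' → Finset ρ)
      (_ : ∑ c ∈ cms, ({Rd c} : Multiset (Finset ρ)) = T)
      (_ : ∀ c ∈ cms, MD M' c (Rd c))
      (_ : ∀ c ∈ cms, ∀ c' ∈ cms, c ≠ c' → Disjoint (c : Set X') (c' : Set X'))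
      (_ : ∀ x ∈ pts, ∀ c ∈ cms, x ∉ (c : Set X'))
      (_ : ∀ z : X', IsClosed ({z} : Set X') → (p : ℕ∞) ≤ idealOrder M'.ideal z → z ∈ pts ∨ ∃ c ∈ cms, z ∈ (c : Set X')),
      ∃ (X'' : Scheme.{0}) (ρ' : X'' ⟶ X₀) (M'' : MarkedIdeal X''), IsMarkedResolution M₀ ρ' M'' := by
  classical
  induction hT with
  | intro T _ ih =>
  intro X' σ M' hσ pts st hclosed hdata cms Rd hTeq hcdata hdisj₁ hdisj₂ hcover
  haveI : IsLocallyNoetherian X' := hσ.isLocallyNoetherian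
  haveI : JacobsonSpace X' := jacobsonSpace_of_isMultipleBlowup hσ
  have hmult' : M'.mult = p := hσ.mult_eq.trans hmult
  rcases cms.eq_empty_or_nonempty with hcms | ⟨c₁, hc₁⟩
  · -- no member: the point forest
    haveI : Std.Irrefl (fun s' s : State K => Edge p Finset.univ s s' ∧ s' ≠ s) := ⟨fun s hs => hs.2 rfl⟩
    have hTp : Acc (Relation.CutExpand (fun s' s : State K => Edge p Finset.univ s s' ∧ s' ≠ s))
        (pts.val.map st) := by
      refine Relation.acc_of_singleton fun s hs => ?_
      rw [Multiset.mem_map] at hs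
      obtain ⟨x, hx, rfl⟩ := hs
      exact (Subrelation.accessible (fun hs => hs.1) (hdata x (Finset.mem_val.mp hx)).2.2.2.1).cutExpand
    refine exists_isMarkedResolution_of_config_local M₀ hE hmult _ hTp X' σ M' hσ pts st rfl hclosed
      (fun z hz hzo => ?_) hdata
    rcases hcover z hz hzo with h | ⟨c, hc, -⟩
    · exact h
    · rw [hcms] at hc; exact absurd hc (Finset.notMem_empty c)
  -- blow up the member `c₁`
  obtain ⟨hreg₁, hsnc₁, hsub₁⟩ := hadm M' c₁ (Rd c₁) hmult' (hcdata c₁ hc₁)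
  set Ce : X'.IdealSheafData := vanishingIdeal c₁ with hCe
  have hπ : IsBlowup (blowup.π Ce) Ce := blowup.isBlowup Ce
  have hCsupp : ∀ z : X', z ∉ (Ce.support : Set X') ↔ z ∉ (c₁ : Set X') := fun z => by
    rw [hCe, Scheme.IdealSheafData.coe_support_vanishingIdeal]
  have h₁ : IsMultipleBlowup M₀ (blowup.π Ce ≫ σ) (M'.transform (blowup.π Ce) Ce) :=
    IsMultipleBlowup.blowup hσ Ce (blowup.π Ce) hπ hreg₁
      (by rw [hCe, Scheme.IdealSheafData.coe_support_vanishingIdeal]; exact hsub₁) hsnc₁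
  haveI : IsLocallyNoetherian (blowup Ce) := h₁.isLocallyNoetherian
  set M'' := M'.transform (blowup.π Ce) Ce with hM''
  -- the members side of the step (generic A4)
  obtain ⟨cms', Rd', hcdata', hdisj₁', ⟨KR, hKR, hTid⟩, hsit, hcov, hscov, hfin⟩ :=
    member_node_step MD lt hadm hsurv hhost M' hmult' cms Rd hcdata hdisj₁ hc₁
  -- leftover points: closed order-`p` points over `c₁` outside all new members
  set ov : Finset (blowup Ce) := hfin.toFinset with hov_def
  have hmem_over : ∀ w, w ∈ ov ↔ IsClosed ({w} : Set (blowup Ce)) ∧ blowup.π Ce w ∈ (c₁ : Set X') ∧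
      (p : ℕ∞) ≤ idealOrder M''.ideal w ∧ ∀ d ∈ cms', w ∉ (d : Set (blowup Ce)) := fun w => by
    rw [hov_def, Set.Finite.mem_toFinset, Set.mem_setOf_eq]
  have hleaf : ∀ w : blowup Ce, IsClosed ({w} : Set (blowup Ce)) → blowup.π Ce w ∈ (c₁ : Set X') →
      (p : ℕ∞) ≤ idealOrder M''.ideal w → (∀ d ∈ cms', w ∉ (d : Set (blowup Ce))) →
      ∃ s : State K, PointData p M'' w s := fun w hw hwc hord hout => by
    rcases hcov w hw hwc hord with ⟨d, hd, hwd⟩ | h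
    · exact absurd hwd (hout d hd)
    · exact h
  -- point survivors
  have hpre : ∀ z : {z // z ∈ pts}, ∃ w : blowup Ce, blowup.π Ce w = z.1 := fun z =>
    exists_eq_of_not_mem_support hπ ((hCsupp z.1).mpr (hdisj₂ z.1 z.2 c₁ hc₁))
  set pre : {z // z ∈ pts} → blowup Ce := fun z => (hpre z).choose with hpre_def
  have hπpre : ∀ z : {z // z ∈ pts}, blowup.π Ce (pre z) = z.1 := fun z => (hpre z).choose_spec
  set surv : Finset (blowup Ce) := pts.attach.image pre with hsurv_def
  have hmem_surv : ∀ w, w ∈ surv ↔ blowup.π Ce w ∈ pts := by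
    intro w
    rw [hsurv_def, Finset.mem_image]
    refine ⟨by rintro ⟨z, -, rfl⟩; rw [hπpre z]; exact z.2, fun hw => ⟨⟨blowup.π Ce w, hw⟩, Finset.mem_attach _ _,
      eq_of_eq_of_not_mem_support hπ (hπpre _) (by rw [hπpre]; exact (hCsupp _).mpr (hdisj₂ _ hw c₁ hc₁))⟩⟩
  have hdisj_os : Disjoint ov surv := Finset.disjoint_left.mpr fun ⦃w⦄ hw hw' =>
    hdisj₂ _ ((hmem_surv w).mp hw') c₁ hc₁ ((hmem_over w).mp hw).2.1
  set pts' : Finset (blowup Ce) := ov.disjUnion surv hdisj_os with hpts'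
  have hmem' : ∀ w, w ∈ pts' ↔ w ∈ ov ∨ w ∈ surv := fun w => Finset.mem_disjUnion
  have hsurv_ord : ∀ w : blowup Ce, blowup.π Ce w ∉ (c₁ : Set X') →
      idealOrder M''.ideal w = idealOrder M'.ideal (blowup.π Ce w) := fun w hwx =>
    idealOrder_controlledTransform_eq_of_eq_of_not_mem_support hπ ((hCsupp _).mpr hwx) M'.ideal M'.mult rfl
  set st' : blowup Ce → State K := fun w =>
    if hc : IsClosed ({w} : Set (blowup Ce)) ∧ blowup.π Ce w ∈ (c₁ : Set X') ∧
        (p : ℕ∞) ≤ idealOrder M''.ideal w ∧ ∀ d ∈ cms', w ∉ (d : Set (blowup Ce)) then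
      (hleaf w hc.1 hc.2.1 hc.2.2.1 hc.2.2.2).choose
    else st (blowup.π Ce w) with hst'
  have hover : ∀ w ∈ ov, PointData p M'' w (st' w) := by
    intro w hw
    have hc := (hmem_over w).mp hw
    have h := (hleaf w hc.1 hc.2.1 hc.2.2.1 hc.2.2.2).choose_spec
    have hst'w : st' w = (hleaf w hc.1 hc.2.1 hc.2.2.1 hc.2.2.2).choose := by rw [hst']; exact dif_pos hc
    rw [hst'w]
    exact h
  have hoff : ∀ w : blowup Ce, blowup.π Ce w ∉ (c₁ : Set X') → st' w = st (blowup.π Ce w) := fun w hwx => by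
    rw [hst']; exact dif_neg fun hc => hwx hc.2.1
  -- the multiset of reading sets decreases
  have hcut : Relation.CutExpand lt (∑ d ∈ cms', ({Rd' d} : Multiset (Finset ρ))) T := by
    refine ⟨KR, Rd c₁, fun R' hR' => hKR R' hR', ?_⟩
    rw [← hTeq]
    exact hTid
  -- recurse on the new stage
  refine ih _ hcut (blowup Ce) (blowup.π Ce ≫ σ) M'' h₁ pts' st' (fun w hw => ?_) (fun w hw => ?_) cms' Rd'
    rfl hcdata' hdisj₁' (fun w hw d hd => ?_) (fun z hz hzo => ?_)
  · -- closedness of the point members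
    rcases (hmem' w).mp hw with hw | hw
    · exact ((hmem_over w).mp hw).1
    · have hz := (hmem_surv w).mp hw
      exact isClosed_singleton_of_not_mem_support hπ (hclosed _ hz) ((hCsupp _).mpr (hdisj₂ _ hz c₁ hc₁))
  · -- data of the point members
    rcases (hmem' w).mp hw with hw | hw
    · exact hover w hw
    · have hz := (hmem_surv w).mp hw
      rw [hoff w (hdisj₂ _ hz c₁ hc₁)]
      exact pointData_of_not_mem_support hπ M' ((hCsupp _).mpr (hdisj₂ _ hz c₁ hc₁)) (hdata _ hz)
  · -- point members avoid members
    rcases (hmem' w).mp hw with hw | hw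
    · exact ((hmem_over w).mp hw).2.2.2 d hd
    · intro hwd
      have hz := (hmem_surv w).mp hw
      rcases hsit d hd w hwd with h | ⟨c, hc, -, h⟩
      · exact hdisj₂ _ hz c₁ hc₁ h
      · exact hdisj₂ _ hz c hc h
  · -- every closed order-`p` point of the new stage is a point member or on a member
    by_cases hzx : blowup.π Ce z ∈ (c₁ : Set X')
    · by_cases hk : ∃ d ∈ cms', z ∈ (d : Set (blowup Ce))
      · exact Or.inr hk
      · push Not at hk
        exact Or.inl ((hmem' z).mpr (Or.inl ((hmem_over z).mpr ⟨hz, hzx, hzo, hk⟩)))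
    · have hzo' : (p : ℕ∞) ≤ idealOrder M'.ideal (blowup.π Ce z) := by rw [← hsurv_ord z hzx]; exact hzo
      rcases hcover _ (isClosed_singleton_π' hπ hz) hzo' with h | ⟨c, hc, hzc⟩
      · exact Or.inl ((hmem' z).mpr (Or.inr ((hmem_surv z).mpr h)))
      · have hcc : c ≠ c₁ := fun h => hzx (by rw [← h]; exact hzc)
        exact Or.inr (hscov z c hc hcc hzc)

/-- **THE NODE THEOREM FOR A MEMBER SYSTEM (σ = 𝟙).** Under (ADM), (WF), (SURV), (HOST): a node `(X₀, M₀)` (`M₀` with snc boundary and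
multiplicity `p`) with point members carrying `PointData` and pairwise disjoint members carrying `MD`, points off members, every closed
order-`p` point a point member or on a member, has a marked resolution. [cite: BierstoneGrigorievMilmanWlodarczyk2011, Def. 3.1.3]
[cite: Hauser2010, §§F–G] -/
theorem exists_isMarkedResolution_of_member_node {X₀ : Scheme.{0}} [IsLocallyNoetherian X₀] [JacobsonSpace X₀]
    (MD : ∀ ⦃X' : Scheme.{0}⦄, MarkedIdeal X' → Closeds X' → Finset ρ → Prop) (lt : Finset ρ → Finset ρ → Prop)
    (hirr : ∀ R : Finset ρ, ¬ lt R R)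
    (hadm : ∀ ⦃X' : Scheme.{0}⦄ [IsLocallyNoetherian X'] (M' : MarkedIdeal X') (c : Closeds X') (R : Finset ρ),
      M'.mult = p → MD M' c R →
      Scheme.IsRegular (vanishingIdeal c).subscheme ∧ HasSNCWith M'.boundary (vanishingIdeal c) ∧ (c : Set X') ⊆ M'.support)
    (hwf : ∀ ⦃X' : Scheme.{0}⦄ (M' : MarkedIdeal X') (c : Closeds X') (R : Finset ρ), MD M' c R → Acc lt R)
    (hsurv : ∀ ⦃X' W : Scheme.{0}⦄ [IsLocallyNoetherian X'] [IsLocallyNoetherian W] {π : W ⟶ X'} {Ce : X'.IdealSheafData},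
      IsBlowup π Ce → ∀ M' : MarkedIdeal X', M'.mult = p → HasSNCWith M'.boundary Ce →
      ∀ (c : Closeds X') (R : Finset ρ), Disjoint (c : Set X') (Ce.support : Set X') → MD M' c R →
      MD (M'.transform π Ce) (c.preimage π.continuous) R)
    (hhost : ∀ ⦃X' : Scheme.{0}⦄ [IsLocallyNoetherian X'] (M' : MarkedIdeal X'), M'.mult = p →
      ∀ (c : Closeds X') (R : Finset ρ), MD M' c R →
      ∃ (ι : Type) (I : Finset ι) (kid : ι → Closeds (blowup (vanishingIdeal c))) (Rk : ι → Finset ρ),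
        (∀ i ∈ I, MD ((M'.transform (blowup.π (vanishingIdeal c)) (vanishingIdeal c))) (kid i) (Rk i) ∧
          (kid i : Set (blowup (vanishingIdeal c))) ⊆ blowup.π (vanishingIdeal c) ⁻¹' (c : Set X') ∧
          (kid i : Set (blowup (vanishingIdeal c))).Nonempty) ∧
        (∀ i ∈ I, ∀ i' ∈ I, i ≠ i' →
          Disjoint (kid i : Set (blowup (vanishingIdeal c))) (kid i' : Set (blowup (vanishingIdeal c)))) ∧
        (∀ i ∈ I, lt (Rk i) R) ∧
        (∀ w : blowup (vanishingIdeal c), IsClosed ({w} : Set (blowup (vanishingIdeal c))) →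
          blowup.π (vanishingIdeal c) w ∈ (c : Set X') →
          (p : ℕ∞) ≤ idealOrder (M'.transform (blowup.π (vanishingIdeal c)) (vanishingIdeal c)).ideal w →
          (∃ i ∈ I, w ∈ (kid i : Set (blowup (vanishingIdeal c)))) ∨
          ∃ s : State K, PointData p (M'.transform (blowup.π (vanishingIdeal c)) (vanishingIdeal c)) w s) ∧
        {w : blowup (vanishingIdeal c) | IsClosed ({w} : Set (blowup (vanishingIdeal c))) ∧
          blowup.π (vanishingIdeal c) w ∈ (c : Set X') ∧
          (p : ℕ∞) ≤ idealOrder (M'.transform (blowup.π (vanishingIdeal c)) (vanishingIdeal c)).ideal w ∧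
          ∀ i ∈ I, w ∉ (kid i : Set (blowup (vanishingIdeal c)))}.Finite)
    (M₀ : MarkedIdeal X₀) (hE : HasSNC M₀.boundary) (hmult : M₀.mult = p)
    (pts : Finset X₀) (st : X₀ → State K) (hclosed : ∀ x ∈ pts, IsClosed ({x} : Set X₀))
    (hdata : ∀ x ∈ pts, PointData p M₀ x (st x))
    (cms : Finset (Closeds X₀)) (Rd : Closeds X₀ → Finset ρ)
    (hcdata : ∀ c ∈ cms, MD M₀ c (Rd c))
    (hdisj₁ : ∀ c ∈ cms, ∀ c' ∈ cms, c ≠ c' → Disjoint (c : Set X₀) (c' : Set X₀))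
    (hdisj₂ : ∀ x ∈ pts, ∀ c ∈ cms, x ∉ (c : Set X₀))
    (hcover : ∀ z : X₀, IsClosed ({z} : Set X₀) → (p : ℕ∞) ≤ idealOrder M₀.ideal z → z ∈ pts ∨ ∃ c ∈ cms, z ∈ (c : Set X₀)) :
    ∃ (X'' : Scheme.{0}) (ρ' : X'' ⟶ X₀) (M'' : MarkedIdeal X''), IsMarkedResolution M₀ ρ' M'' := by
  classical
  haveI : Std.Irrefl lt := ⟨hirr⟩
  have hT : Acc (Relation.CutExpand lt) (∑ c ∈ cms, ({Rd c} : Multiset (Finset ρ))) := by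
    refine Relation.acc_of_singleton fun R hR => ?_
    obtain ⟨c, hc, hR⟩ := Multiset.mem_sum.mp hR
    rw [Multiset.mem_singleton] at hR
    subst hR
    exact (hwf M₀ c (Rd c) (hcdata c hc)).cutExpand
  exact exists_isMarkedResolution_of_member_forest MD lt hadm hsurv hhost M₀ hE hmult _ hT X₀ (𝟙 X₀) M₀
    (IsMultipleBlowup.refl M₀) pts st hclosed hdata cms Rd rfl hcdata hdisj₁ hdisj₂ hcover

end MemberForest

end Equimultiple

end Summit.ResolutionOfSingularities.ResolutionOfSingularities.Theorems.PIDim4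

end
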